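import Summits.QuantumFields.YangMills.Theorems.UnitScaleTiltProp7SectET3HilbertLettersT3
import Mathlib.Analysis.InnerProductSpace.Dual
import Mathlib.Topology.Algebra.Module.Star
import HarnessLib

/-!
# Route `UnitScaleTilt`, crux «MinimiserStabilityRegPr» (stmt-QuantumFields-19200, stub EX) ∕ (O″χ) B0 (stmt-QuantumFields-20520), node N06(d = 3), route (α) —
# DEFINITIONS FILE, LAYER 0 BRICK L0b: **THE WILSON HESSIAN `Δ^η(U₀)` OF [Balaban1985BackgroundPropagators] (3.7)∕(3.12) AT A T³ MEMBER** — «the quadratic terms in the expansion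
# (3.7) DEFINE the basic operator … we denote it by Δ^η(U)» (p. 392): the second derivative of the (complexified) Wilson action along the exponential chart at `U₀`, read as an
# operator of the weighted `L²` space of brick L0a in PRINT'S NORMALISATION (action `A^η`, trace `tr 1 = 1`, pairing (3.11)), with the conversion constant to the route's
# `wilsonAction4` carried BY NAME (`cη`, ★★OWNER ym3-torus-plan g26 ACK 32 (q2)∕normalisation)

Cell `ym-inputs` (desk `pub/ym-inputs`, INPUT-LIST.md v6 §4 row p01 = I-06 B0 DEFINER LEAD, layer 0 = the (L2)∕(L4)∕(L6) DEFINITION programme of WANTED №g25-1; memo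
`pub/ym-inputs/DEFINER-MEMO-T3.md` §2 L0b; seat `ym-inputs-p01`).  YM₃ on T³ is ladder rung R3, NOT the Clay problem; nothing here is a claim about a stub, a crux, d = 4 or the mass
gap.  `--supports stmt-QuantumFields-20520` (B0 of (O″χ) needs N06(d = 3), RULING g26-№2 (4)); count-neutral; review lane (definitions + `rfl`∕`simp` glue; the rows — «hermitian
operator», print's explicit formula (3.10) `Δ = D*D + Δ′`, the identity with the route's `wilsonAction4`, positivity on the regular class — are the def-free siblings ∕ N06).

THE PRINT.  [Balaban1985BackgroundPropagators] (3.7) p. 391: *«A^η(U′U₀) = A^η(U₀) + ⟨D^η_{U₀}A, η⁻² Im ∂U₀⟩ + ½⟨A, Δ^η(U₀)A⟩ + ⋯. This expansion is valid also for configurations A and U₀ with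
values respectively in the complexified algebra 𝔤ᶜ and the group Gᶜ, we have to interpret only Re U₀(∂p) and Im U₀(∂p) as Re U₀(∂p) = ½(U₀(∂p) + U₀(−∂p)), Im U₀(∂p) = (1∕2i)(U₀(∂p) −
U₀(−∂p))»*; p. 392: *«by X·Y = tr XY. Let us recall that the trace is normalized, i.e., tr 1 = 1 … The quadratic terms in the expansion (3.7) define the basic operator generalizing the
operator ∂*∂ in the Abelian case. We denote it by Δ^η(U), or simply by Δ. For U with values in the unitary group U(N) it is a hermitian operator given by the quadratic form ⟨A, ΔA⟩ =
⟨A, D*DA⟩ + ⟨A, Δ′A⟩ … (3.10) … A^η(exp iηA U) = A^η(U) + ⟨A, J⟩ + ½⟨A, ΔA⟩ + ⋯. (3.12)»*; the action `A^η(U) = Σ_p η^{d−4}(1 − Re tr U(∂p))` ([Balaban1987RG1] (0.2); `d = 3`: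
weight `η⁻¹`).  Render of record: lit g23, `pub/pub-balaban/b2b-balaban-ref1/pages/1985-cmp99-background-propagators/…-p003∕p004-x4.png` (bus 2026-08-28T08:55:16Z).

WHY ∕ HOW.  Print DEFINES `Δ^η(U₀)` as the Hermitian operator of the quadratic term of `A ↦ A^η(e^{iηA}U₀)` in the pairing (3.11); (3.10) is its explicit lattice formula.  Brick L0d's
`laplaceA … Δx U₀ = Δx(U₀) + DRD* + Q*aQ` takes the Hessian LETTER `Δx`; this file constructs the letter print means, at the member, in three honest steps: (i) the COMPLEXIFIED Wilson
action `actionC W = Σ_p (1 − ½·tr W(∂p))` of a `GL₂(ℂ)`-valued configuration (print's «interpret Re U(∂p) as ½(U(∂p) + U(−∂p))»: on unitary `W` it is the route's `wilsonAction4`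
= `Σ_p (1 − Re tr W(∂p)∕2)` — `UnitaryModel.reTr := Re Tr ∕ n` — as a real number; that identity is a row), a POLYNOMIAL in the entries, hence ℂ-differentiable; (ii) its second Fréchet
derivative `hessForm U₀` at `X = 0` along the exponential chart `X ↦ (e^{X(b)}U₀(b))_b` of the route (`B7Prop1Explicit.expUnit`, `T3SectALandauChart.bgUnits` — the chart of
✓`Prop7SymAvgTwSym.dbarTwS`), a ℂ-bilinear form on the exponents `X ∈ gl₂(ℂ)^{bonds}`; (iii) the operator: print's `⟨A, ΔA′⟩` (A-units, `X = iηA`, `d = 3`) is the SESQUILINEAR form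
`(A, A′) ↦ −η·D²(actionC∘chart)(0)[Aᴴ, A′]` (conjugate-linear slot through the real structure `A ↦ Aᴴ` of `𝔲(2)ᶜ = gl₂(ℂ)`), and in brick L0a's pairing `⟪A, B⟫ = c₀·Σ_b tr(A(b)ᴴB(b))`
(print: `η³·tr_norm = (η³∕2)·tr`) the operator with `⟪ΔA, A′⟫ = (2c₀∕η³)·⟨A, ΔA′⟩_print` is `Δ` itself; so `DeltaL2 U₀ :=` Mathlib's `InnerProductSpace.continuousLinearMapOfBilin` of the bounded
sesquilinear form `hessSesq U₀ v w := (−2c₀∕η²)·hessForm U₀ (toL2⁻¹v)ᴴ (toL2⁻¹w)`.  The route's own Hessian `∂²_t wilsonAction4((e^{itY}U₀)_b)|₀` (exponent units, Hermitian `Y`) is then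
`cη·⟪toL2 Y, DeltaL2 U₀ (toL2 Y)⟫` with **`cη := η²∕(2c₀)`** — the constant RULED to be carried by name; that identity (reality of the form on Hermitian directions + the chain rule through
`expHerm`) is a ROW, not asserted here.

WHAT IS DEFINED (member `F`, `n K`, weight `c₀`, background `U₀`): `chartU F K U₀ X` (the `GL₂`-valued configuration `e^{X}·U₀`), `plaqU W p` (`W(∂p)`), `actionC F K W`, `hessForm F K U₀ :
V →L[ℂ] V →L[ℂ] ℂ` (`V := PBond (F.P K) 0 → M₂(ℂ)`), `toL2CLM F K c₀ : BondL2K … →L[ℂ] V` (brick L0a's `toL2⁻¹`, continuous), `hessSesq F n K c₀ U₀ : BondL2K →L⋆[ℂ] BondL2K →L[ℂ] ℂ`,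
**`DeltaL2 F n K c₀ U₀ : BondL2K ℂ 3 (periodsT3 F K) c₀ W₂ →L[ℂ] BondL2K …`** (print's `Δ^η(U₀)`), **`DeltaWilson F n K c₀ : ∀ U₀, BondL2K →ₗ[ℂ] BondL2K`** (the `Δx` slot of brick L0d; print's `G₀ =
(Δ + DRD* + Q*aQ)⁻¹` of p.421 is L0d's `GT … (DeltaWilson …)`), **`cη F n K c₀ : ℝ`**.  Glue: `chartU_zero` (`e^{0}U₀ = U₀`), `actionC` ∕ `plaqU` unfoldings, ★`inner_DeltaL2_left`
(`⟪DeltaL2 U₀ v, w⟫ = hessSesq U₀ v w` — (3.12) as the defining property), `hessSesq_apply`, `DeltaWilson_apply`, `cη_pos`.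
NOT HERE (rows ∕ next bricks): `Δ_π` (3.119) and `Δ₁` (3.128) (they add the gauge-invariant correction `DG′R_SD*` and the `C^{(2)}`, `J` terms to THIS letter — brick L0b part 2 after
`G′ := (Δ′_a)⁻¹` is typed); (3.10) explicit; self-adjointness; positivity.
HONEST SCOPE.  Definitions; no estimate; nothing of print asserted; not a proof of any stub; nothing continuum ∕ OS ∕ mass-gap ∕ Clay.

References: T. Bałaban, CMP **99** (1985) 389–434 [Balaban1985BackgroundPropagators] ((3.4)–(3.7) p.391, (3.8)–(3.12) p.392, p.421 `G₀`); CMP **109** (1987) 249–301 [Balaban1987RG1] ((0.2) p.252);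
CMP **98** (1985) 17–51 [Balaban1985Averaging] ((9) p.19, (18) p.21).
-/

set_option autoImplicit false

noncomputable section

open scoped InnerProductSpace ComplexConjugate Matrix.Norms.L2Operator BigOperators

namespace Summit.QuantumFields.YangMills.Theorems.Prop7SectET3WilsonHessian

open Literature.MathematicalPhysics.QuantumFieldTheory.Balaban1983to89
open Literature.MathematicalPhysics.QuantumFieldTheory.Balaban1983to89.T3ContinuumYM3Torus
open T3SectALandauChart (eta eta_pos bgUnits)
open B9SectCLatticeCarrier (Bond)
open B9Eq311L2Pairing (WL2)
open B11Eq103H1Complex (BondL2K)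
open B10Eq27TorusAxialLog (holT)
open B7Prop1Explicit (expUnit plaqWord)
open Summit.QuantumFields.YangMills.Theorems.Prop7SectET3Transport (periodsT3)
open Summit.QuantumFields.YangMills.Theorems.Prop7SectET3HilbertLetters (W₂ toL2)

/-! ## §1 The complexified Wilson action and the exponential chart at `U₀` -/

section Action

variable (F : T3Family) (K : ℕ)

/-- **THE EXPONENTIAL CHART AT THE BACKGROUND**: the `GL₂(ℂ)`-valued configuration `(e^{X(b)}·U₀(b))_b` of an exponent field `X ∈ gl₂(ℂ)^{bonds}` (print's `U′U₀`, `U′ = e^{iηA}`, with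
`X = iηA`; the chart of ✓`Prop7SymAvgTwSym.dbarTwS`). [cite: Balaban1985BackgroundPropagators, (3.6)–(3.7) p.391, (3.12) p.392] -/
def chartU (U₀ : GaugeField (F.P K) 0 (Matrix.specialUnitaryGroup (Fin 2) ℂ)) (X : PBond (F.P K) 0 → Matrix (Fin 2) (Fin 2) ℂ) :
    PBond (F.P K) 0 → (Matrix (Fin 2) (Fin 2) ℂ)ˣ :=
  fun b => expUnit (X b) * bgUnits F K U₀ b

/-- **THE PLAQUETTE VARIABLE `W(∂p)`** of a `GL₂(ℂ)`-valued configuration (the transport `holT` around `∂p = (μ, ν, −μ, −ν)` from `p.src`, [Balaban1985Averaging] (9)).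
[cite: Balaban1985Averaging, (9) p.19] -/
def plaqU (W : PBond (F.P K) 0 → (Matrix (Fin 2) (Fin 2) ℂ)ˣ) (p : Plaq (F.P K) 0) : (Matrix (Fin 2) (Fin 2) ℂ)ˣ :=
  holT W p.src (plaqWord p.μ p.ν)

/-- **THE COMPLEXIFIED WILSON ACTION `Σ_p (1 − ½·tr W(∂p))`** of a `GL₂(ℂ)`-valued configuration — print's `A^η` with «Re U(∂p) interpreted as ½(U(∂p) + U(−∂p))» for the complexified group,
WITHOUT the weight `η^{d−4}` (carried by `cη`) and with the normalised trace `tr_norm = ½·tr` of `M₂`; on unitary `W` its real part is the route's `wilsonAction4` (`reTr := Re Tr∕2`) — a row.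
[cite: Balaban1985BackgroundPropagators, (3.7) p.391; Balaban1987RG1, (0.2) p.252] -/
def actionC (W : PBond (F.P K) 0 → (Matrix (Fin 2) (Fin 2) ℂ)ˣ) : ℂ :=
  ∑ p : Plaq (F.P K) 0, (1 - (2 : ℂ)⁻¹ * Matrix.trace ((plaqU F K W p : (Matrix (Fin 2) (Fin 2) ℂ)ˣ) : Matrix (Fin 2) (Fin 2) ℂ))

/-- **THE SECOND FRÉCHET DERIVATIVE OF THE COMPLEXIFIED ACTION ALONG THE CHART AT `X = 0`** — the ℂ-bilinear form `D²(actionC ∘ chartU U₀)(0)` on the exponents: «the quadratic terms in the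
expansion (3.7)». [cite: Balaban1985BackgroundPropagators, (3.7) p.391, (3.12) p.392] -/
def hessForm (U₀ : GaugeField (F.P K) 0 (Matrix.specialUnitaryGroup (Fin 2) ℂ)) :
    (PBond (F.P K) 0 → Matrix (Fin 2) (Fin 2) ℂ) →L[ℂ] (PBond (F.P K) 0 → Matrix (Fin 2) (Fin 2) ℂ) →L[ℂ] ℂ :=
  fderiv ℂ (fun X => fderiv ℂ (fun Y => actionC F K (chartU F K U₀ Y)) X) 0

variable {F K}

/-- `e^{0}·U₀ = U₀` (the chart is centred at the background). [cite: Balaban1985BackgroundPropagators, (3.12) p.392] -/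
theorem chartU_zero (U₀ : GaugeField (F.P K) 0 (Matrix.specialUnitaryGroup (Fin 2) ℂ)) : chartU F K U₀ 0 = bgUnits F K U₀ := by
  funext b
  simp only [chartU, Pi.zero_apply]
  have h1 : expUnit (0 : Matrix (Fin 2) (Fin 2) ℂ) = 1 := by
    ext
    simp [expUnit]
  rw [h1, one_mul]

/-- Unfolding `plaqU`. [cite: Balaban1985Averaging, (9) p.19] -/
theorem plaqU_def (W : PBond (F.P K) 0 → (Matrix (Fin 2) (Fin 2) ℂ)ˣ) (p : Plaq (F.P K) 0) : plaqU F K W p = holT W p.src (plaqWord p.μ p.ν) := rfl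

/-- Unfolding `actionC`. [cite: Balaban1985BackgroundPropagators, (3.7) p.391] -/
theorem actionC_def (W : PBond (F.P K) 0 → (Matrix (Fin 2) (Fin 2) ℂ)ˣ) :
    actionC F K W = ∑ p : Plaq (F.P K) 0, (1 - (2 : ℂ)⁻¹ * Matrix.trace ((plaqU F K W p : (Matrix (Fin 2) (Fin 2) ℂ)ˣ) : Matrix (Fin 2) (Fin 2) ℂ)) := rfl

end Action

/-! ## §2 The operator `Δ^η(U₀)` of (3.12) in the weighted `L²` space of brick L0a, print's normalisation -/

section Operator

variable (F : T3Family) (n K : ℕ) (c₀ : ℝ) [Fact (0 < c₀)]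

/-- Brick L0a's `toL2⁻¹` as a CONTINUOUS linear map (finite dimension). [folklore] -/
def toL2CLM : BondL2K ℂ 3 (periodsT3 F K) c₀ W₂ →L[ℂ] (PBond (F.P K) 0 → Matrix (Fin 2) (Fin 2) ℂ) :=
  LinearMap.toContinuousLinearMap (toL2 F K c₀).symm.toLinearMap

/-- **PRINT'S QUADRATIC FORM `⟨A, Δ^η(U₀)A′⟩` AS A BOUNDED SESQUILINEAR FORM ON `L²`**, in the normalisation that makes the associated operator EQUAL to print's `Δ^η(U₀)` in brick L0a's pairing:
`hessSesq U₀ v w := (−2c₀∕η²)·D²(actionC∘chartU U₀)(0)[(toL2⁻¹v)ᴴ, toL2⁻¹w]` (d = 3: `A^η = η⁻¹·actionC`, directions `X = iηA` give `(iη)²`, pairing `η³·tr_norm` vs `c₀·tr` gives `2c₀∕η³`; the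
conjugate-linear slot is the real structure `A ↦ Aᴴ` of `𝔲(2)ᶜ`). [cite: Balaban1985BackgroundPropagators, (3.10)–(3.12) p.392] -/
def hessSesq (U₀ : GaugeField (F.P K) 0 (Matrix.specialUnitaryGroup (Fin 2) ℂ)) :
    BondL2K ℂ 3 (periodsT3 F K) c₀ W₂ →L⋆[ℂ] BondL2K ℂ 3 (periodsT3 F K) c₀ W₂ →L[ℂ] ℂ :=
  ((-(2 * (c₀ : ℂ)) / (((eta F n K : ℝ) : ℂ)) ^ 2) •
    ((ContinuousLinearMap.compL ℂ (BondL2K ℂ 3 (periodsT3 F K) c₀ W₂) (PBond (F.P K) 0 → Matrix (Fin 2) (Fin 2) ℂ) ℂ).flip (toL2CLM F K c₀))).comp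
      ((hessForm F K U₀).comp
        (((starL ℂ : (PBond (F.P K) 0 → Matrix (Fin 2) (Fin 2) ℂ) ≃L⋆[ℂ] (PBond (F.P K) 0 → Matrix (Fin 2) (Fin 2) ℂ)) :
            (PBond (F.P K) 0 → Matrix (Fin 2) (Fin 2) ℂ) →L⋆[ℂ] (PBond (F.P K) 0 → Matrix (Fin 2) (Fin 2) ℂ)).comp
          (toL2CLM F K c₀)))

/-- **PRINT'S WILSON HESSIAN `Δ^η(U₀)` AT THE MEMBER** — «we denote it by Δ^η(U), or simply by Δ» (p. 392) — the bounded operator of the weighted `L²` space of the vector fields representing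
the sesquilinear form `hessSesq U₀`: `⟪DeltaL2 U₀ v, w⟫ = hessSesq U₀ v w` (Mathlib's `InnerProductSpace.continuousLinearMapOfBilin`).  Print's explicit formula (3.10) `Δ = D*D + Δ′`, «hermitian»,
and positivity on the regular class are ROWS about this object, not asserted. [cite: Balaban1985BackgroundPropagators, (3.10)–(3.12) p.392] -/
def DeltaL2 (U₀ : GaugeField (F.P K) 0 (Matrix.specialUnitaryGroup (Fin 2) ℂ)) : BondL2K ℂ 3 (periodsT3 F K) c₀ W₂ →L[ℂ] BondL2K ℂ 3 (periodsT3 F K) c₀ W₂ :=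
  InnerProductSpace.continuousLinearMapOfBilin (hessSesq F n K c₀ U₀)

/-- **THE `Δx` SLOT OF BRICK L0d FILLED WITH `Δ^η`**: `DeltaWilson U₀ := DeltaL2 U₀` as a linear map — so that L0d's `GT … (DeltaWilson …) U₀` is print's `G₀ = (Δ + DRD* + Q*aQ)⁻¹` (p. 421) ∕ (3.26)–(3.27),
the operator of Sects. 3.A–C; print's `G` of (3.122)∕(3.126) uses `Δ_π` = this letter + the correction (3.119) (brick L0b part 2). [cite: Balaban1985BackgroundPropagators, (3.26)–(3.27) p.395, p.421] -/
def DeltaWilson : GaugeField (F.P K) 0 (Matrix.specialUnitaryGroup (Fin 2) ℂ) → (BondL2K ℂ 3 (periodsT3 F K) c₀ W₂ →ₗ[ℂ] BondL2K ℂ 3 (periodsT3 F K) c₀ W₂) :=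
  fun U₀ => (DeltaL2 F n K c₀ U₀ : BondL2K ℂ 3 (periodsT3 F K) c₀ W₂ →ₗ[ℂ] BondL2K ℂ 3 (periodsT3 F K) c₀ W₂)

/-- **THE NORMALISATION CONSTANT `cη := η²∕(2c₀)`** between the route's Hessian and print's `Δ^η` (★★OWNER ACK 32: carried BY NAME, never absorbed): the intended row is
`∂²_t wilsonAction4 ((e^{itY(b)}U₀(b))_b)|₀ = cη · re ⟪toL2 Y, DeltaL2 U₀ (toL2 Y)⟫` for Hermitian `Y` (exponent units; `wilsonAction4 = Re actionC` on unitary fields, `X = iηA`). With print's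
`c₀ = η³`: `cη = 1∕(2η)`. [cite: Balaban1985BackgroundPropagators, (3.12) p.392; Balaban1987RG1, (0.2) p.252] -/
def cη : ℝ := (eta F n K) ^ 2 / (2 * c₀)

variable {F n K c₀}

/-- Unfolding the sesquilinear form: `hessSesq U₀ v w = (−2c₀∕η²) · hessForm U₀ (star (toL2⁻¹ v)) (toL2⁻¹ w)`. [cite: Balaban1985BackgroundPropagators, (3.12) p.392] -/
theorem hessSesq_apply (U₀ : GaugeField (F.P K) 0 (Matrix.specialUnitaryGroup (Fin 2) ℂ)) (v w : BondL2K ℂ 3 (periodsT3 F K) c₀ W₂) :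
    hessSesq F n K c₀ U₀ v w =
      ((-(2 * (c₀ : ℂ)) / (((eta F n K : ℝ) : ℂ)) ^ 2)) * hessForm F K U₀ (star ((toL2 F K c₀).symm v)) ((toL2 F K c₀).symm w) := by
  simp [hessSesq, toL2CLM]

/-- ★ **(3.12) AS THE DEFINING PROPERTY: `⟪Δ^η(U₀)v, w⟫ = hessSesq U₀ v w`** — the operator represents print's quadratic form in the pairing (3.11) of brick L0a.
[cite: Balaban1985BackgroundPropagators, (3.11)–(3.12) p.392] -/
theorem inner_DeltaL2_left (U₀ : GaugeField (F.P K) 0 (Matrix.specialUnitaryGroup (Fin 2) ℂ)) (v w : BondL2K ℂ 3 (periodsT3 F K) c₀ W₂) :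
    ⟪DeltaL2 F n K c₀ U₀ v, w⟫_ℂ = hessSesq F n K c₀ U₀ v w :=
  InnerProductSpace.continuousLinearMapOfBilin_apply (hessSesq F n K c₀ U₀) v w

/-- Unfolding the `Δx` slot. [cite: Balaban1985BackgroundPropagators, (3.26) p.395] -/
theorem DeltaWilson_apply (U₀ : GaugeField (F.P K) 0 (Matrix.specialUnitaryGroup (Fin 2) ℂ)) (v : BondL2K ℂ 3 (periodsT3 F K) c₀ W₂) :
    DeltaWilson F n K c₀ U₀ v = DeltaL2 F n K c₀ U₀ v := rfl

omit [Fact (0 < c₀)] in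
/-- `cη > 0` for `c₀ > 0`. [folklore] -/
theorem cη_pos (hc : 0 < c₀) : 0 < cη F n K c₀ := by
  unfold cη
  exact div_pos (pow_pos (eta_pos F n K) 2) (by linarith)

end Operator

/-! ## §3 (v1.1, APPEND-ONLY — ERRATUM AND THE LETTER OF RECORD) print's own complexification «Re U(∂p) = ½(U(∂p) + U(−∂p))» and the Hermitian operator `Δ^η(U₀)`

**ERRATUM (same seat, same session).**  §1–§2 above complexify the action as `actionC W = Σ_p (1 − ½·tr W(∂p))` — the holomorphic extension of the COMPLEX-valued function `1 − ½tr U(∂p)`, whose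
REAL PART is the action on unitary fields.  Print's prescription (p. 391) is different and is the right one: «we have to interpret only Re U₀(∂p) … as ½(U₀(∂p) + U₀(−∂p))», i.e. the holomorphic
extension of the REAL action itself, `actionRe W := Σ_p (1 − ¼·(tr W(∂p) + tr W(∂p)⁻¹))`, which is REAL and EQUAL to `wilsonAction4` on unitary fields.  At a curved background the two second
derivatives differ by a non-zero skew part (`tr((D_{U₀}A)(p)² U₀(∂p))` is complex for Hermitian `A` when `U₀(∂p) ≠ 1`; print's (3.7)∕(3.10) keep exactly its Hermitian parts `Re U₀(∂p)`,
`Im U₀(∂p)`), so the operator `DeltaL2` of §2 is NOT Hermitian at curved `U₀` — its Hermitian part is `Δ^η(U₀)` — and at `U₀ = 1` the two coincide.  **`actionC`, `hessForm`, `hessSesq`,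
`DeltaL2`, `DeltaWilson` are RETIRED (kept, append-only); the letters of record are `actionRe`, `hessFormRe`, `hessSesqRe`, `DeltaEta`, `DeltaEtaSlot` below**, with the SAME normalisation
`cη` (the leading-order check `⟨A, D*DA⟩_print = (η∕2)·Σ_p tr((curl A)²)` is unchanged: `¼(tr e^{F} + tr e^{−F}) = ½tr 1 + ¼tr F² + O(F⁴)`). -/

section PrintComplexification

variable (F : T3Family) (n K : ℕ) (c₀ : ℝ)

/-- **PRINT'S COMPLEXIFIED WILSON ACTION** — «interpret Re U(∂p) as ½(U(∂p) + U(−∂p))» (p. 391), `U(−∂p) = U(∂p)⁻¹`: `actionRe W := Σ_p (1 − ¼·(tr W(∂p) + tr W(∂p)⁻¹))` (normalised trace `½tr`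
of `M₂`, weight `η^{d−4}` carried by `cη`); on unitary `W`, `tr W(∂p)⁻¹ = conj (tr W(∂p))`, so this IS `Σ_p (1 − Re tr W(∂p)∕2) = wilsonAction4 W` (a row). THE LETTER OF RECORD (supersedes `actionC`).
[cite: Balaban1985BackgroundPropagators, (3.7) p.391; Balaban1987RG1, (0.2) p.252] -/
def actionRe (W : PBond (F.P K) 0 → (Matrix (Fin 2) (Fin 2) ℂ)ˣ) : ℂ :=
  ∑ p : Plaq (F.P K) 0, (1 - (4 : ℂ)⁻¹ * (Matrix.trace ((plaqU F K W p : (Matrix (Fin 2) (Fin 2) ℂ)ˣ) : Matrix (Fin 2) (Fin 2) ℂ) +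
    Matrix.trace (((plaqU F K W p)⁻¹ : (Matrix (Fin 2) (Fin 2) ℂ)ˣ) : Matrix (Fin 2) (Fin 2) ℂ)))

/-- **THE SECOND FRÉCHET DERIVATIVE OF PRINT'S COMPLEXIFIED ACTION ALONG THE CHART AT `X = 0`** — the ℂ-bilinear quadratic term of (3.7) (supersedes `hessForm`).
[cite: Balaban1985BackgroundPropagators, (3.7) p.391, (3.12) p.392] -/
def hessFormRe (U₀ : GaugeField (F.P K) 0 (Matrix.specialUnitaryGroup (Fin 2) ℂ)) :
    (PBond (F.P K) 0 → Matrix (Fin 2) (Fin 2) ℂ) →L[ℂ] (PBond (F.P K) 0 → Matrix (Fin 2) (Fin 2) ℂ) →L[ℂ] ℂ :=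
  fderiv ℂ (fun X => fderiv ℂ (fun Y => actionRe F K (chartU F K U₀ Y)) X) 0

variable {F K}

/-- Unfolding `actionRe`. [cite: Balaban1985BackgroundPropagators, (3.7) p.391] -/
theorem actionRe_def (W : PBond (F.P K) 0 → (Matrix (Fin 2) (Fin 2) ℂ)ˣ) :
    actionRe F K W = ∑ p : Plaq (F.P K) 0, (1 - (4 : ℂ)⁻¹ * (Matrix.trace ((plaqU F K W p : (Matrix (Fin 2) (Fin 2) ℂ)ˣ) : Matrix (Fin 2) (Fin 2) ℂ) +
      Matrix.trace (((plaqU F K W p)⁻¹ : (Matrix (Fin 2) (Fin 2) ℂ)ˣ) : Matrix (Fin 2) (Fin 2) ℂ))) := rfl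

variable (F K) [Fact (0 < c₀)]

/-- **PRINT'S QUADRATIC FORM `⟨A, Δ^η(U₀)A′⟩` AS A BOUNDED SESQUILINEAR FORM ON `L²`** (the formula of `hessSesq` at print's complexification `hessFormRe`): `(−2c₀∕η²)·D²(actionRe∘chartU U₀)(0)[(toL2⁻¹v)ᴴ, toL2⁻¹w]`;
REAL on Hermitian directions at every unitary `U₀` (print: «hermitian operator»; a row). THE LETTER OF RECORD (supersedes `hessSesq`). [cite: Balaban1985BackgroundPropagators, (3.10)–(3.12) p.392] -/
def hessSesqRe (U₀ : GaugeField (F.P K) 0 (Matrix.specialUnitaryGroup (Fin 2) ℂ)) :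
    BondL2K ℂ 3 (periodsT3 F K) c₀ W₂ →L⋆[ℂ] BondL2K ℂ 3 (periodsT3 F K) c₀ W₂ →L[ℂ] ℂ :=
  ((-(2 * (c₀ : ℂ)) / (((eta F n K : ℝ) : ℂ)) ^ 2) •
    ((ContinuousLinearMap.compL ℂ (BondL2K ℂ 3 (periodsT3 F K) c₀ W₂) (PBond (F.P K) 0 → Matrix (Fin 2) (Fin 2) ℂ) ℂ).flip (toL2CLM F K c₀))).comp
      ((hessFormRe F K U₀).comp
        (((starL ℂ : (PBond (F.P K) 0 → Matrix (Fin 2) (Fin 2) ℂ) ≃L⋆[ℂ] (PBond (F.P K) 0 → Matrix (Fin 2) (Fin 2) ℂ)) :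
            (PBond (F.P K) 0 → Matrix (Fin 2) (Fin 2) ℂ) →L⋆[ℂ] (PBond (F.P K) 0 → Matrix (Fin 2) (Fin 2) ℂ)).comp
          (toL2CLM F K c₀)))

/-- **PRINT'S WILSON HESSIAN `Δ^η(U₀)` AT THE MEMBER — THE LETTER OF RECORD** (supersedes `DeltaL2`): the bounded operator of brick L0a's weighted `L²` space representing `hessSesqRe U₀`,
`⟪DeltaEta U₀ v, w⟫ = hessSesqRe U₀ v w` ((3.12)); print's (3.10) `Δ = D*D + Δ′`, «hermitian», positivity on the regular class and `∂²_t wilsonAction4((e^{itY}U₀))|₀ = cη·⟪toL2 Y, DeltaEta U₀ (toL2 Y)⟫`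
are ROWS about this object. [cite: Balaban1985BackgroundPropagators, (3.10)–(3.12) p.392] -/
def DeltaEta (U₀ : GaugeField (F.P K) 0 (Matrix.specialUnitaryGroup (Fin 2) ℂ)) : BondL2K ℂ 3 (periodsT3 F K) c₀ W₂ →L[ℂ] BondL2K ℂ 3 (periodsT3 F K) c₀ W₂ :=
  InnerProductSpace.continuousLinearMapOfBilin (hessSesqRe F n K c₀ U₀)

/-- **THE `Δx` SLOT OF BRICK L0d FILLED WITH PRINT'S `Δ^η` — THE SLOT OF RECORD** (supersedes `DeltaWilson`): L0d's `GT … (DeltaEtaSlot …) U₀` is print's `G₀ = (Δ + DRD* + Q*aQ)⁻¹` (p.421)∕(3.27).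
[cite: Balaban1985BackgroundPropagators, (3.26)–(3.27) p.395, p.421] -/
def DeltaEtaSlot : GaugeField (F.P K) 0 (Matrix.specialUnitaryGroup (Fin 2) ℂ) → (BondL2K ℂ 3 (periodsT3 F K) c₀ W₂ →ₗ[ℂ] BondL2K ℂ 3 (periodsT3 F K) c₀ W₂) :=
  fun U₀ => (DeltaEta F n K c₀ U₀ : BondL2K ℂ 3 (periodsT3 F K) c₀ W₂ →ₗ[ℂ] BondL2K ℂ 3 (periodsT3 F K) c₀ W₂)

variable {F n K c₀}

/-- Unfolding: `hessSesqRe U₀ v w = (−2c₀∕η²) · hessFormRe U₀ (star (toL2⁻¹ v)) (toL2⁻¹ w)`. [cite: Balaban1985BackgroundPropagators, (3.12) p.392] -/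
theorem hessSesqRe_apply (U₀ : GaugeField (F.P K) 0 (Matrix.specialUnitaryGroup (Fin 2) ℂ)) (v w : BondL2K ℂ 3 (periodsT3 F K) c₀ W₂) :
    hessSesqRe F n K c₀ U₀ v w =
      ((-(2 * (c₀ : ℂ)) / (((eta F n K : ℝ) : ℂ)) ^ 2)) * hessFormRe F K U₀ (star ((toL2 F K c₀).symm v)) ((toL2 F K c₀).symm w) := by
  simp [hessSesqRe, toL2CLM]

/-- ★ **(3.12) AS THE DEFINING PROPERTY OF THE LETTER OF RECORD: `⟪Δ^η(U₀)v, w⟫ = hessSesqRe U₀ v w`.** [cite: Balaban1985BackgroundPropagators, (3.11)–(3.12) p.392] -/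
theorem inner_DeltaEta_left (U₀ : GaugeField (F.P K) 0 (Matrix.specialUnitaryGroup (Fin 2) ℂ)) (v w : BondL2K ℂ 3 (periodsT3 F K) c₀ W₂) :
    ⟪DeltaEta F n K c₀ U₀ v, w⟫_ℂ = hessSesqRe F n K c₀ U₀ v w :=
  InnerProductSpace.continuousLinearMapOfBilin_apply (hessSesqRe F n K c₀ U₀) v w

/-- Unfolding the slot of record. [cite: Balaban1985BackgroundPropagators, (3.26) p.395] -/
theorem DeltaEtaSlot_apply (U₀ : GaugeField (F.P K) 0 (Matrix.specialUnitaryGroup (Fin 2) ℂ)) (v : BondL2K ℂ 3 (periodsT3 F K) c₀ W₂) :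
    DeltaEtaSlot F n K c₀ U₀ v = DeltaEta F n K c₀ U₀ v := rfl

end PrintComplexification

end Summit.QuantumFields.YangMills.Theorems.Prop7SectET3WilsonHessian

end
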